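import Summits.QuantumAdvantage.QuantumAdvantage.Theorems.LinnikCubicClassGroupsDegreeOnePrimesEscapeRayClassDHTheta
import Summits.QuantumAdvantage.QuantumAdvantage.Theorems.LinnikCubicClassGroupsDegreeOnePrimesEscapeRayClassRealZero
import Summits.QuantumAdvantage.QuantumAdvantage.Theorems.LinnikCubicClassGroupsDegreeOnePrimesEscapeClassPNTDHLinnik
import Summits.QuantumAdvantage.QuantumAdvantage.Theorems.LinnikCubicClassGroupsDegreeOnePrimesEscapeRayClassGroupCard
import Literature.NumberTheory.LFunctions.PrimesInRayClasses
import HarnessLib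

/-!
# Linnik's theorem for cosets of a congruence class group, VII: the prime number theorem for cosets with relative
# error in the Linnik range, and the least prime ideal in a coset (Fogels–Weiss), unconditionally

Topic `Summits/QuantumAdvantage/QuantumAdvantage/Theorems`, cell B2b-1 (linnik-cubic), PART A (gen 22); helper toward
the crux `DegreeOnePrimesEscape` (stmt-QuantumAdvantage-11543) of route `LinnikCubicClassGroups`.  HONEST FRAMING: the
value of this file is a THEOREM (kernel-checked, GRH-free, Siegel-free) — NOT summit progress (the route still rests on
the hypothesis-type target `PureCubicClassNumberHard`).

For a number field `K` of degree `n > 1`, an abelian Frobenius datum `f : 𝔭 ↦ f 𝔭 ∈ G` killing the narrow ray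
`mod 𝔪 ≠ 0` whose non-trivial characters are non-principal off `𝔪` (a congruence class group `H mod 𝔪`,
`G = J^𝔪/H`; canonical case `G = Cl_K^𝔪`, `f = primeRayClass`), with `|G| ≤ Q_𝔪⁴`, `Q_𝔪 = |d_K| n^n N𝔪`
(`rayCondQ`):
* `thetaFiber_relative` — **the prime number theorem for cosets with RELATIVE error in the Linnik range**: for
  `ε > 0` there are `L = L(n,ε)`, `0 < c ≤ 1/(8(n²+1))` with: EITHER `|θ_τ(x) − x/|G|| ≤ ε x/|G|` for all
  `x ≥ Q_𝔪^L` and all `τ ∈ G`, OR a real character `ψ₁` of `G` has a real zero `β₁ ∈ (1 − c/(log(|d_K|N𝔪)+log 4), 1)`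
  of its Hecke `L`-function and `|θ_τ(x) − M_τ(x)/|G|| ≤ ε M_τ(x)/|G|`, `M_τ(x) = x − ψ₁(τ) x^{β₁}/β₁ > 0`;
* `exists_prime_fiber_absNorm_le` — **the least prime ideal in a coset**: `∃ L = L(n) > 0`, every `τ ∈ G` contains a
  prime `𝔭 ∤ 𝔪` with `f 𝔭 = τ` and `N𝔭 ≤ Q_𝔪^L`;
* `exists_prime_rayClass_absNorm_le` — **the canonical case, UNCONDITIONAL**: every narrow ray class `mod 𝔪 ≠ 0` of
  every number field of degree `n` contains a prime ideal `𝔭 ∤ 𝔪` of norm `≤ (|d_K| n^n N𝔪)^{L(n)}` (the size hypothesis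
  is discharged by `natCard_rayClassGroup_le_rayCondQ_pow`, `|Cl_K^𝔪| ≤ Q_𝔪⁴`).
The three principles and the effective repulsion of the exceptional zero all enter as PROVED tree theorems
(`exists_exceptionalZero_congruence_const`, `rayFam_density`, `deuringHeilbronn_congruence`, `rayRealZero_repulsion`).
In print: Fogels (1962, per field), Weiss 1983 (`N𝔭 ≤ (n^{An} |d_K| N𝔮)^{C}`
with absolute exponents), Thorner–Zaman 2017 Thm 3.1 (explicit); here the exponent depends on the degree.
References: A. Weiss, J. reine angew. Math. 338 (1983), §6 [Weiss1983]; J. Thorner, A. Zaman, ANT 11 (2017), Thm 3.1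
[ThornerZaman2017]; ANT 13 (2019), Thm 1.4 [ThornerZaman2019].
-/

noncomputable section

open Complex Real Set Filter Topology NumberField IsDedekindDomain
open scoped NumberField nonZeroDivisors

namespace Summit.QuantumAdvantage.QuantumAdvantage.Theorems.DegreeOnePrimesEscape

open Literature.NumberTheory.LFunctions Literature.NumberTheory.LFunctions.NumberField
  Literature.NumberTheory.LFunctions.EntireEF Literature.NumberTheory.LFunctions.TZWeight
  Literature.NumberTheory.LFunctions.AbelianDensity Literature.NumberTheory.GaloisRepresentations
open scoped Classical

/-! ### The inputs at the size parameter `Q = Q_𝔪⁴` -/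

/-- The `θ_τ`-dichotomy with every analytic hypothesis discharged, at the size parameter `Q = Q_𝔪⁴`: density from
`rayFam_density` (residue bound `Residue.residueLowerBound_all`), repulsion from `rayRealZero_repulsion`. -/
theorem thetaFiber_dichotomy_all (n : ℕ) (hn : 1 < n) {η : ℝ} (hη : 0 < η) :
    ∃ a₂ c : ℝ, 1 ≤ a₂ ∧ 0 < c ∧ c ≤ 1 / (8 * ((n : ℝ) ^ 2 + 1)) ∧
    ∀ (K : Type) [Field K] [NumberField K], Module.finrank ℚ K = n →
    ∀ (G : Type) [CommGroup G] [Finite G] (𝔪 : Ideal (𝓞 K)) (f : HeightOneSpectrum (𝓞 K) → G)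
      (h𝔪 : 𝔪 ≠ ⊥) (hray : ArtinKillsRay 𝔪 f)
      (hsep : ∀ χ : AddChar (Additive G) ℂ, χ ≠ 0 →
        ∃ v : HeightOneSpectrum (𝓞 K), ¬ 𝔪 ≤ v.asIdeal ∧ χ (Additive.ofMul (f v)) ≠ 1),
      (Nat.card G : ℝ) ≤ rayCondQ K 𝔪 ^ (4 : ℕ) →
      (∀ x : ℝ, (rayCondQ K 𝔪 ^ (4 : ℕ)) ^ a₂ ≤ x → ∀ τ : G,
          |fiberTheta 𝔪 f τ x - x / Nat.card G| ≤ η * x / Nat.card G) ∨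
      ∃ (ψ₁ : AddChar (Additive G) ℂ) (β₁ : ℝ), rayFamF h𝔪 hray hsep ψ₁ β₁ = 0 ∧
          1 - c / (Real.log (((discr K).natAbs : ℝ) * ((Ideal.absNorm 𝔪 : ℕ) : ℝ)) + Real.log 4) < β₁ ∧ β₁ < 1 ∧
          ψ₁ + ψ₁ = 0 ∧
          ∀ x : ℝ, (rayCondQ K 𝔪 ^ (4 : ℕ)) ^ a₂ ≤ x → ∀ τ : G,
            |fiberTheta 𝔪 f τ x - (x - (ψ₁ (Additive.ofMul τ)).re * x ^ β₁ / β₁) / Nat.card G| ≤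
              η * x * min 1 ((1 - β₁) * Real.log x) / Nat.card G := by
  obtain ⟨A, hA0, hA⟩ := Residue.residueLowerBound_all n
  obtain ⟨b, D, hb, hD, hdens⟩ := rayFam_density n hn A
  obtain ⟨c₁, hc₁, hc₁1, hrep⟩ := rayRealZero_repulsion n hn
  have ha : (1 : ℝ) ≤ max A 4 / 4 := by
    rw [le_div_iff₀ (by norm_num)]; linarith [le_max_right A 4]
  obtain ⟨a₂, c, ha₂1, hc, hcn, hθ⟩ := thetaFiber_dichotomy_dh n hn hb hD ha hη hc₁ hc₁1
  refine ⟨a₂, c, ha₂1, hc, hcn, fun K _ _ hKn G _ _ 𝔪 f h𝔪 hray hsep hG ↦ ?_⟩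
  have hK : 1 < Module.finrank ℚ K := by rw [hKn]; exact hn
  set R : ℝ := rayCondQ K 𝔪 with hR
  have hR12 : (12 : ℝ) ≤ R := twelve_le_rayCondQ hK h𝔪
  have hR1 : (1 : ℝ) ≤ R := by linarith
  have hR0 : (0 : ℝ) < R := by linarith
  have hRQ : R ≤ R ^ (4 : ℕ) := by
    calc R = R ^ 1 := (pow_one R).symm
      _ ≤ R ^ 4 := pow_le_pow_right₀ hR1 (by norm_num)
  have hG' : (Nat.card G : ℝ) ≤ (R ^ (4 : ℕ)) ^ (4 : ℕ) := by
    refine hG.trans ?_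
    calc R ^ (4 : ℕ) = (R ^ 4) ^ 1 := (pow_one _).symm
      _ ≤ (R ^ 4) ^ 4 := pow_le_pow_right₀ (one_le_pow₀ hR1) (by norm_num)
  -- residue bound in `R`-form
  have hκ : R ^ (-A) ≤ dedekindZeta_residue K := by
    refine le_trans ?_ (hA K hKn)
    have hQ0 : 0 < ThornerZaman.condQn K := by
      have := ThornerZaman.twelve_le_condQn (K := K) hK; linarith
    exact Real.rpow_le_rpow_of_nonpos hQ0 (condQn_le_rayCondQ h𝔪) (by linarith)
  -- density in `R⁴`-form
  have hlog4 : max A 4 / 4 * Real.log (R ^ (4 : ℕ)) = max A 4 * Real.log R := by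
    rw [Real.log_pow]; push_cast; ring
  have hdens' : ∀ (T : ℝ), 1 ≤ T → ∀ u : AddChar (Additive G) ℂ → Finset ℂ,
      (∀ ψ, ∀ ρ ∈ u ψ, rayFamF h𝔪 hray hsep ψ ρ = 0 ∧ 1 / 4 ≤ ρ.re ∧ ρ.re < 1 ∧ |ρ.im| ≤ T) →
      ∀ α : ℝ, α ≤ 1 →
        ∑ ψ, ∑ ρ ∈ u ψ with α ≤ ρ.re, (analyticOrderNatAt (rayFamF h𝔪 hray hsep ψ) ρ : ℝ) ≤
          D * Real.exp (b * (max A 4 / 4 * Real.log (R ^ (4 : ℕ)) + Real.log (T + 4))) ^ (1 - α) := by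
    intro T hT u hu α hα
    rw [hlog4]
    exact hdens K hKn G 𝔪 f h𝔪 hray hsep hκ hG T hT u hu α hα
  -- repulsion in `R⁴`-form
  have hpow : (R ^ (4 : ℕ)) ^ (-(2 : ℝ)) = R ^ (-(8 : ℝ)) := by
    rw [← Real.rpow_natCast, ← Real.rpow_mul hR0.le]; norm_num
  have hrep' : ∀ ψ₁ : AddChar (Additive G) ℂ, ψ₁ + ψ₁ = 0 → ∀ β₁ : ℝ, β₁ < 1 →
      rayFamF h𝔪 hray hsep ψ₁ β₁ = 0 → c₁ * (R ^ (4 : ℕ)) ^ (-(2 : ℝ)) ≤ 1 - β₁ := by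
    intro ψ₁ h1 β₁ hβ h0
    rw [hpow]; exact hrep K hKn G 𝔪 f h𝔪 hray hsep ψ₁ h1 β₁ hβ h0
  exact hθ K hKn G 𝔪 f h𝔪 hray hsep (R ^ (4 : ℕ)) hRQ hG' hdens' hrep'

/-! ### The prime number theorem for cosets with relative error, Linnik range -/

set_option maxHeartbeats 800000 in
/-- **The prime number theorem for the cosets of a congruence class group with RELATIVE error in the Linnik range,
unconditional** (see the module docstring). [cite: Weiss1983, §6] [cite: ThornerZaman2017, Theorem 3.1] -/
theorem thetaFiber_relative (n : ℕ) (hn : 1 < n) {ε : ℝ} (hε : 0 < ε) :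
    ∃ L c : ℝ, 1 ≤ L ∧ 0 < c ∧ c ≤ 1 / (8 * ((n : ℝ) ^ 2 + 1)) ∧
    ∀ (K : Type) [Field K] [NumberField K], Module.finrank ℚ K = n →
    ∀ (G : Type) [CommGroup G] [Finite G] (𝔪 : Ideal (𝓞 K)) (f : HeightOneSpectrum (𝓞 K) → G)
      (h𝔪 : 𝔪 ≠ ⊥) (hray : ArtinKillsRay 𝔪 f)
      (hsep : ∀ χ : AddChar (Additive G) ℂ, χ ≠ 0 →
        ∃ v : HeightOneSpectrum (𝓞 K), ¬ 𝔪 ≤ v.asIdeal ∧ χ (Additive.ofMul (f v)) ≠ 1),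
      (Nat.card G : ℝ) ≤ rayCondQ K 𝔪 ^ (4 : ℕ) →
      (∀ x : ℝ, rayCondQ K 𝔪 ^ L ≤ x → ∀ τ : G,
          |fiberTheta 𝔪 f τ x - x / Nat.card G| ≤ ε * x / Nat.card G) ∨
      ∃ (ψ₁ : AddChar (Additive G) ℂ) (β₁ : ℝ), rayFamF h𝔪 hray hsep ψ₁ β₁ = 0 ∧
          1 - c / (Real.log (((discr K).natAbs : ℝ) * ((Ideal.absNorm 𝔪 : ℕ) : ℝ)) + Real.log 4) < β₁ ∧ β₁ < 1 ∧
          ψ₁ + ψ₁ = 0 ∧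
          ∀ x : ℝ, rayCondQ K 𝔪 ^ L ≤ x → ∀ τ : G,
            0 < x - (ψ₁ (Additive.ofMul τ)).re * x ^ β₁ / β₁ ∧
            |fiberTheta 𝔪 f τ x - (x - (ψ₁ (Additive.ofMul τ)).re * x ^ β₁ / β₁) / Nat.card G| ≤
              ε * (x - (ψ₁ (Additive.ofMul τ)).re * x ^ β₁ / β₁) / Nat.card G := by
  have hε4 : 0 < ε / 4 := by positivity
  obtain ⟨a₂, c, ha₂1, hc, hcn, hθ⟩ := thetaFiber_dichotomy_all n hn hε4
  have hn2 : (2 : ℝ) ≤ n := by exact_mod_cast hn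
  refine ⟨4 * max a₂ 16, c, by linarith [le_max_right a₂ 16], hc, hcn,
    fun K _ _ hKn G _ _ 𝔪 f h𝔪 hray hsep hG ↦ ?_⟩
  have hK : 1 < Module.finrank ℚ K := by rw [hKn]; exact hn
  set R : ℝ := rayCondQ K 𝔪 with hR
  have hR12 : (12 : ℝ) ≤ R := twelve_le_rayCondQ hK h𝔪
  have hR1 : (1 : ℝ) < R := by linarith
  have hlogR : 2 ≤ Real.log R := two_lt_log_twelve.le.trans (Real.log_le_log (by norm_num) hR12)
  set h : ℝ := (Nat.card G : ℝ) with hh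
  have hh1 : 1 ≤ h := by
    rw [hh]; exact_mod_cast Nat.one_le_iff_ne_zero.2 (Nat.card_pos (α := G)).ne'
  have hh0 : 0 < h := by linarith
  -- sizes at `x ≥ R^{4 max(a₂,16)}`
  have hsz : ∀ x : ℝ, R ^ (4 * max a₂ 16) ≤ x → (R ^ (4 : ℕ)) ^ a₂ ≤ x ∧ 1 < x ∧ 16 ≤ Real.log x := by
    intro x hx
    have hpow : (R ^ (4 : ℕ)) ^ a₂ ≤ R ^ (4 * max a₂ 16) := by
      rw [← Real.rpow_natCast, ← Real.rpow_mul (by linarith)]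
      exact Real.rpow_le_rpow_of_exponent_le hR1.le (by push_cast; nlinarith [le_max_left a₂ 16])
    have hxa₂ := hpow.trans hx
    have hxR : R ≤ x := by
      have : R ^ (1 : ℝ) ≤ R ^ (4 * max a₂ 16) :=
        Real.rpow_le_rpow_of_exponent_le hR1.le (by linarith [le_max_right a₂ 16])
      rw [Real.rpow_one] at this; linarith
    have hLQ : 4 * max a₂ 16 * Real.log R ≤ Real.log x := by
      have := Real.log_le_log (by positivity) hx
      rwa [Real.log_rpow (by linarith)] at this
    have h16 : (16 : ℝ) ≤ max a₂ 16 := le_max_right _ _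
    exact ⟨hxa₂, by linarith, by nlinarith⟩
  rcases hθ K hKn G 𝔪 f h𝔪 hray hsep hG with hgood | ⟨ψ₁, β₁, hz, hβlow, hβ1, hreal, hexc⟩
  · left
    intro x hx τ
    obtain ⟨hxa₂, hx1, -⟩ := hsz x hx
    have := hgood x hxa₂ τ
    have hx0 : 0 < x := by linarith
    have : ε / 4 * x / h ≤ ε * x / h := by
      rw [div_le_div_iff_of_pos_right hh0]; nlinarith
    linarith
  · right
    have hβ34 : 3 / 4 ≤ β₁ := by
      have hlog4 : 1 < Real.log 4 := by
        rw [show (4:ℝ) = 2 ^ 2 by norm_num, Real.log_pow]; have := Real.log_two_gt_d9; push_cast; linarith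
      have hlogd : 0 ≤ Real.log (((discr K).natAbs : ℝ) * ((Ideal.absNorm 𝔪 : ℕ) : ℝ)) :=
        Real.log_nonneg (one_le_discr_mul_absNorm K h𝔪)
      have hc4 : c ≤ 1 / 4 :=
        hcn.trans (by rw [div_le_div_iff_of_pos_left one_pos (by positivity) (by norm_num)]; nlinarith)
      have : c / (Real.log (((discr K).natAbs : ℝ) * ((Ideal.absNorm 𝔪 : ℕ) : ℝ)) + Real.log 4) ≤ 1 / 4 := by
        rw [div_le_iff₀ (by linarith)]; nlinarith
      linarith
    refine ⟨ψ₁, β₁, hz, hβlow, hβ1, hreal, fun x hx τ ↦ ?_⟩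
    obtain ⟨hxa₂, hx1, hL16⟩ := hsz x hx
    have hx0 : 0 < x := by linarith
    have hb := hexc x hxa₂ τ
    have hr := (addChar_real_apply hreal (Additive.ofMul τ)).2.2
    have hM := sub_mul_rpow_div_ge hx1 hL16 hβ34 hβ1 hr
    have hm0 : 0 < min 1 ((1 - β₁) * Real.log x) := lt_min one_pos (mul_pos (by linarith) (by linarith))
    have hM0 : 0 < x - (ψ₁ (Additive.ofMul τ)).re * x ^ β₁ / β₁ := lt_of_lt_of_le (by positivity) hM
    refine ⟨hM0, hb.trans ?_⟩
    rw [div_le_div_iff_of_pos_right hh0]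
    nlinarith

/-! ### The least prime ideal in a coset -/

/-- **Linnik's theorem for the cosets of a congruence class group (Fogels–Weiss, degree-dependent exponent),
unconditional**: for `n > 1` there is `L = L(n) > 0` such that for every number field `K` of degree `n`, every
abelian Frobenius datum `f` killing the narrow ray `mod 𝔪 ≠ 0` with non-trivial characters non-principal off `𝔪` and
`|G| ≤ Q_𝔪⁴`, and every `τ ∈ G`, there is a prime `𝔭 ∤ 𝔪` with `f 𝔭 = τ` and `N𝔭 ≤ Q_𝔪^L`, `Q_𝔪 = |d_K| n^n N𝔪`.
[cite: Weiss1983, §6] [cite: ThornerZaman2017, Theorem 3.1] -/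
theorem exists_prime_fiber_absNorm_le (n : ℕ) (hn : 1 < n) :
    ∃ L : ℝ, 0 < L ∧ ∀ (K : Type) [Field K] [NumberField K], Module.finrank ℚ K = n →
    ∀ (G : Type) [CommGroup G] [Finite G] (𝔪 : Ideal (𝓞 K)) (f : HeightOneSpectrum (𝓞 K) → G),
      𝔪 ≠ ⊥ → ArtinKillsRay 𝔪 f →
      (∀ χ : AddChar (Additive G) ℂ, χ ≠ 0 →
        ∃ v : HeightOneSpectrum (𝓞 K), ¬ 𝔪 ≤ v.asIdeal ∧ χ (Additive.ofMul (f v)) ≠ 1) →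
      (Nat.card G : ℝ) ≤ rayCondQ K 𝔪 ^ (4 : ℕ) →
      ∀ τ : G, ∃ v : HeightOneSpectrum (𝓞 K), ¬ 𝔪 ≤ v.asIdeal ∧ f v = τ ∧
        (Ideal.absNorm v.asIdeal : ℝ) ≤ rayCondQ K 𝔪 ^ L := by
  obtain ⟨L, c, hL1, -, -, hθ⟩ := thetaFiber_relative n hn (by norm_num : (0 : ℝ) < 1 / 2)
  refine ⟨L, by linarith, fun K _ _ hKn G _ _ 𝔪 f h𝔪 hray hsep hG τ ↦ ?_⟩
  have hK : 1 < Module.finrank ℚ K := by rw [hKn]; exact hn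
  set R : ℝ := rayCondQ K 𝔪 with hR
  have hR12 : (12 : ℝ) ≤ R := twelve_le_rayCondQ hK h𝔪
  set x : ℝ := R ^ L with hx
  set h : ℝ := (Nat.card G : ℝ) with hh
  have hh1 : 1 ≤ h := by
    rw [hh]; exact_mod_cast Nat.one_le_iff_ne_zero.2 (Nat.card_pos (α := G)).ne'
  have hh0 : 0 < h := by linarith
  have hxR : R ≤ x := by
    have := Real.rpow_le_rpow_of_exponent_le (by linarith : (1 : ℝ) ≤ R) hL1
    rwa [Real.rpow_one] at this
  have hx0 : 0 < x := by linarith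
  have hθpos : 0 < fiberTheta 𝔪 f τ x := by
    rcases hθ K hKn G 𝔪 f h𝔪 hray hsep hG with hgood | ⟨ψ₁, β₁, -, -, -, -, hexc⟩
    · have h1 := (abs_sub_le_iff.1 (hgood x le_rfl τ)).2
      have h2 : 0 < x / h - 1 / 2 * x / h := by
        rw [← sub_div]; exact div_pos (by linarith) hh0
      linarith
    · obtain ⟨hM0, hb⟩ := hexc x le_rfl τ
      have h1 := (abs_sub_le_iff.1 hb).2
      set M : ℝ := x - (ψ₁ (Additive.ofMul τ)).re * x ^ β₁ / β₁
      have h2 : 0 < M / h - 1 / 2 * M / h := by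
        rw [← sub_div]; exact div_pos (by linarith) hh0
      linarith
  exact exists_prime_of_fiberTheta_pos τ hθpos

/-- **The least prime ideal in a narrow ray class, unconditionally** (canonical case `G = Cl_K^𝔪`, `f = primeRayClass`;
Fogels–Weiss with a degree-dependent exponent): for `n > 1` there is `L = L(n) > 0` such that for every number field
`K` of degree `n`, every `𝔪 ≠ 0` and every narrow ray class `τ mod 𝔪` there is a prime ideal `𝔭 ∤ 𝔪` in `τ` with
`N𝔭 ≤ (|d_K| n^n N𝔪)^L`.  GRH-free, Siegel-free, no size hypothesis (`|Cl_K^𝔪| ≤ Q_𝔪⁴` by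
`natCard_rayClassGroup_le_rayCondQ_pow`). [cite: Weiss1983, §6] [cite: ThornerZaman2017, Theorem 3.1] -/
theorem exists_prime_rayClass_absNorm_le (n : ℕ) (hn : 1 < n) :
    ∃ L : ℝ, 0 < L ∧ ∀ (K : Type) [Field K] [NumberField K], Module.finrank ℚ K = n →
    ∀ (𝔪 : Ideal (𝓞 K)) (h𝔪 : 𝔪 ≠ ⊥) (τ : RayClassGroup 𝔪),
      ∃ v : HeightOneSpectrum (𝓞 K), ¬ 𝔪 ≤ v.asIdeal ∧ primeRayClass 𝔪 h𝔪 v = τ ∧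
        (Ideal.absNorm v.asIdeal : ℝ) ≤ rayCondQ K 𝔪 ^ L := by
  obtain ⟨L, hL, h⟩ := exists_prime_fiber_absNorm_le n hn
  refine ⟨L, hL, fun K _ _ hKn 𝔪 h𝔪 τ ↦ ?_⟩
  haveI : Finite (RayClassGroup 𝔪) := finite_rayClassGroup h𝔪
  have hK : 1 < Module.finrank ℚ K := by rw [hKn]; exact hn
  exact h K hKn (RayClassGroup 𝔪) 𝔪 (primeRayClass 𝔪 h𝔪) h𝔪 (artinKillsRay_primeRayClass h𝔪)
    (fun χ hχ ↦ exists_charFun_primeRayClass_ne_one h𝔪 χ hχ) (natCard_rayClassGroup_le_rayCondQ_pow hK h𝔪) τ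

end Summit.QuantumAdvantage.QuantumAdvantage.Theorems.DegreeOnePrimesEscape

end
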